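import Mathlib.Data.Nat.Choose.Basic
import Mathlib.Data.List.Basic

/-!
# Kernel-checked rows of the kangaroo atlas at `𝔽₄`-rational points (resolution observatory, `pub-rosobs`)

The atlas' robustness sweep `kmax = 2` (KANGAROO-ATLAS-G3.md §B) follows the classical pair
`(order, shade)` of [cite: Hauser2010, §F–§G] through point blow-ups at ALL `𝔽_{p²}`-rational
equimultiple points. The two Python engines implement `𝔽_{p^k}` differently (polynomial basis vs
exp/log tables); this file is a THIRD implementation of the `𝔽₄` arithmetic on the one dimension-3
row of the Brieskorn–Pham `q = 4` family that kangaroos, `x⁴ + y⁹ + z¹⁰` over `𝔽₂`, at its two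
`𝔽₄ \ 𝔽₂`-rational kangaroo points:

* antelope residual `y²z⁶ + y¹⁰z⁵`, `r = (2, 5)`, shade `1` (the state reached by the charts
  `z`, `y` at the origins; certified over `𝔽₂` in `KangarooAtlasCertDim4.bp_p2e2_shades`);
* chart `y`, point `z = ω` (and `z = ω² = ω + 1`), `ω² + ω + 1 = 0`: shade `2` — an increase;
* the two states are Frobenius conjugates of each other (the coefficientwise Frobenius `c ↦ c²`
  of the `z = ω` state is the `z = ω²` state), as the engines print.

Conventions as in `KangarooAtlasCert` (cleaning = removal of `q`-th-power monomials; `r` accumulates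
by `D' = D^strict + (ord_a F − q)·Y'`, translated components reset; `shade = ord F_clean − Σ r_i`).
The field `𝔽₄` is the four-element type `{0, 1, ω, ω²}` with the tables written out, so that every
statement is closed by `decide` (kernel reduction, no `native_decide`).

This is a CERTIFICATE of finitely many computations, not a theorem about resolution.
-/

namespace Literature.AlgebraicGeometry.Resolution.KangarooAtlasCertF4

/-- the field with four elements, `ω² = ω + 1`. [folklore] -/
inductive GF4 where
  | zero | one | om | om2
  deriving DecidableEq, Repr

namespace GF4

/-- addition (characteristic 2: `a + a = 0`, `1 + ω = ω²`). [folklore] -/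
def add : GF4 → GF4 → GF4
  | zero, b => b
  | a, zero => a
  | one, one => zero | one, om => om2 | one, om2 => om
  | om, one => om2 | om, om => zero | om, om2 => one
  | om2, one => om | om2, om => one | om2, om2 => zero

/-- multiplication (`ω·ω = ω²`, `ω·ω² = 1`, `ω²·ω² = ω`). [folklore] -/
def mul : GF4 → GF4 → GF4
  | zero, _ => zero
  | _, zero => zero
  | one, b => b
  | a, one => a
  | om, om => om2 | om, om2 => one
  | om2, om => one | om2, om2 => om

/-- `n • a` in characteristic 2. [folklore] -/
def nsmul (n : ℕ) (a : GF4) : GF4 := if n % 2 = 0 then zero else a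

/-- `a ^ n`. [folklore] -/
def pow (a : GF4) : ℕ → GF4
  | 0 => one
  | n + 1 => mul a (pow a n)

/-- the Frobenius `c ↦ c²`. [folklore] -/
def frob (a : GF4) : GF4 := mul a a

end GF4

/-- exponent vector of a monomial in `y₁,…,y_m`. [folklore] -/
abbrev Mon := List ℕ
/-- sparse polynomial over `𝔽₄`. [folklore] -/
abbrev Poly := List (Mon × GF4)

/-- total degree. [folklore] -/
def deg (m : Mon) : ℕ := m.sum

/-- add one term to a normalised term list. [folklore] -/
def addTerm (t : Mon × GF4) : Poly → Poly
  | [] => if t.2 = GF4.zero then [] else [t]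
  | (m, c) :: rest =>
      if m = t.1 then
        (let s := GF4.add c t.2; if s = GF4.zero then rest else (m, s) :: rest)
      else (m, c) :: addTerm t rest

/-- collect equal monomials, drop zero coefficients. [folklore] -/
def normalize (P : Poly) : Poly := P.foldl (fun acc t => addTerm t acc) []

/-- order at the origin (`0` for the zero polynomial; callers test emptiness). [folklore] -/
def ord (P : Poly) : ℕ :=
  match P with
  | [] => 0
  | t :: rest => rest.foldl (fun a s => min a (deg s.1)) (deg t.1)

/-- cleaning: remove all `q`-th-power monomials (`𝔽₄` is perfect). [cite: Hauser2010, §G] -/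
def clean (q : ℕ) (P : Poly) : Poly := P.filter (fun t => t.1.any (fun e => e % q ≠ 0))

/-- point blow-up, chart `y_j`, strict transform divided by `y_j^q`. [cite: Hauser2010, §G] -/
def blowup (j q : ℕ) (P : Poly) : Poly := P.map (fun t => (t.1.set j (deg t.1 - q), t.2))

/-- `y_i ↦ y_i + b` on one variable, by the binomial theorem. [folklore] -/
def translateVar (i : ℕ) (b : GF4) (P : Poly) : Poly :=
  normalize (P.flatMap (fun t =>
    let n := t.1.getD i 0
    (List.range (n + 1)).map (fun k =>
      (t.1.set i k, GF4.nsmul (Nat.choose n k) (GF4.mul t.2 (GF4.pow b (n - k)))))))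

/-- translation `y ↦ y + b`, one variable at a time. [folklore] -/
def translate (b : List GF4) (P : Poly) : Poly :=
  (List.range b.length).foldl
    (fun acc i => if b.getD i GF4.zero = GF4.zero then acc else translateVar i (b.getD i GF4.zero) acc) P

/-- a state of the walk. [cite: Hauser2010, §F] -/
structure State where
  F : Poly
  r : List ℕ
  deriving Repr, DecidableEq

/-- Hauser's shade `ord F_clean − Σ r_i`. [cite: Hauser2010, §F] -/
def shade (s : State) : ℕ := ord s.F - s.r.sum

/-- one blow-up step at `(chart j, point b)`; `none` if the point is not `q`-fold. [cite: Hauser2010, §G] -/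
def step (q : ℕ) (s : State) (j : ℕ) (b : List GF4) : Option State :=
  let oF := ord s.F
  let rj := s.r.set j (oF - q)
  let G := translate b (blowup j q s.F)
  if G.all (fun t => deg t.1 = 0 ∨ q ≤ deg t.1) then
    let Gc := clean q (G.filter (fun t => deg t.1 ≠ 0))
    let rb := (List.range rj.length).map (fun i => if b.getD i GF4.zero ≠ GF4.zero then 0 else rj.getD i 0)
    some ⟨Gc, rb⟩
  else none

/-- coefficientwise Frobenius of a state (the Galois conjugate point's state). [folklore] -/
def frobState (s : State) : State := ⟨s.F.map (fun t => (t.1, GF4.frob t.2)), s.r⟩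

/-! ## The row `bp-p2e2-y9z10` (`x⁴ + y⁹ + z¹⁰`, `p = 2`, `q = 4`, variables `(y, z)`) -/

/-- the antelope `y²z⁶ + y¹⁰z⁵`, `r = (2, 5)` (atlas row, computation). [folklore] -/
def antelope : State := ⟨[([2, 6], GF4.one), ([10, 5], GF4.one)], [2, 5]⟩

/-- its shade is `1`. [folklore] -/
theorem antelope_shade : shade antelope = 1 := by decide

/-- chart `y`, point `z = ω`: the cleaned residual is
`ω·y⁴z² + y⁴z⁶ + ω²·y¹¹ + ω·y¹¹z + ω·y¹¹z⁴ + y¹¹z⁵`, `r = (4, 0)`, shade `6 − 4 = 2` — an increase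
at an `𝔽₄ \ 𝔽₂`-rational point (atlas row, computation; both engines print this state). [folklore] -/
theorem omega_kangaroo :
    step 4 antelope 0 [GF4.zero, GF4.om] =
      some ⟨[([4, 2], GF4.om), ([4, 6], GF4.one), ([11, 0], GF4.om2), ([11, 1], GF4.om),
             ([11, 4], GF4.om), ([11, 5], GF4.one)], [4, 0]⟩ := by decide

/-- shades `1, 2` along that step. [folklore] -/
theorem omega_shades :
    (step 4 antelope 0 [GF4.zero, GF4.om]).map shade = some 2 := by decide

/-- chart `y`, point `z = ω²`: shade `2` as well. [folklore] -/
theorem omega2_shades :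
    (step 4 antelope 0 [GF4.zero, GF4.om2]).map shade = some 2 := by decide

/-- the `z = ω²` state is the Frobenius conjugate of the `z = ω` state. [folklore] -/
theorem omega2_is_frob_of_omega :
    (step 4 antelope 0 [GF4.zero, GF4.om]).map frobState = step 4 antelope 0 [GF4.zero, GF4.om2] := by
  decide

/-- the `𝔽₂`-point `z = 1` of the same chart gives shade `2` too (same value as in
`KangarooAtlasCertDim4.bp_p2e2_shades`, now over the `𝔽₄` model). [folklore] -/
theorem one_shades :
    (step 4 antelope 0 [GF4.zero, GF4.one]).map shade = some 2 := by decide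

/-- Moh's bound at the `z = ω` increase: `2 ≤ 1 + 2^{e−1} = 1 + 2`. [cite: Moh1987, Stability Theorem] -/
theorem omega_moh :
    ∀ s ∈ step 4 antelope 0 [GF4.zero, GF4.om], shade s ≤ shade antelope + 2 := by decide

/-- control: the origin of chart `y` is a stall, residual `y⁴z⁶ + y¹¹z⁵`, `r = (4, 5)`,
shade `10 − 9 = 1` (atlas row `/z/y/y`, computation). [folklore] -/
theorem origin_stall :
    step 4 antelope 0 [GF4.zero, GF4.zero] = some ⟨[([4, 6], GF4.one), ([11, 5], GF4.one)], [4, 5]⟩ := by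
  decide

end Literature.AlgebraicGeometry.Resolution.KangarooAtlasCertF4
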